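import Literature.InformationTheory.QuantumCodes.TwoBlockOrbitReduction
import HarnessLib

/-!
# Orbit-minimal (one representative per translation orbit) distance certificates for BB codes

Companion to `TwoBlockOrbitReduction.lean`.  There the translation group `ℤ_ℓ × ℤ_m` of a
bivariate-bicycle code `QC(A, B)` (acting on both qubit blocks, [BravyiEtAl2024, SI §9.2]) is used in
TRANSVERSAL form (pin a base qubit).  Here it is used in ORBIT-MINIMAL form — the generic
`exists_mem_key_le` of `OrbitReduction.lean` instantiated to `BB.Code`: for any ranking `key` of
vectors in a well-ordered type (e.g. the colex rank of the support bitmask), a `Z`-logical of weight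
`≤ w` exists iff one exists whose `key` is minimal among its `ℓm` translates
(`exists_zLogical_key_le_translate`); hence a weight lower bound may be checked on translation-minimal
`Z`-logicals only (`lt_hammingNorm_zLogical_of_key_le_translate`), and an explicit `Z`-logical of
weight `d` plus that check gives `C.d = d` (`d_eq_of_witness_of_key_le_translate`) — the shape of a
kernel-A enumeration certificate that visits one pattern per translation orbit (`÷ ℓm`; `÷ 72` for
`[[144,12,12]]`, LADDER-QEC director D8 (ii-A)).

Everything here is PROVED; no named facts, no definitions.

## References
* [BravyiEtAl2024] S. Bravyi et al., Nature 627 (2024) 778–782 = arXiv:2308.07915, Lemma 1 (held text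
  chunk p0009 L74–77) and Supplementary Information §9.2 (p0021 L60 – p0022 L12).

## Tree search (2026-08-26)
Reused: `exists_mem_key_le`, `mulVec_comp_equiv_symm_eq_zero_iff`, `comp_equiv_symm_mem_rowSpace_iff`
(`OrbitReduction.lean`); `BB.Code.HX_submatrix_translate`, `HZ_submatrix_translate`
(`TwoBlockOrbitReduction.lean`); `hammingNorm_comp_equiv` (`HypergraphProductKernels.lean`);
`BB.Code.d_eq_dZ`, `CSSCode.le_dZ`, `dZ_le_hammingNorm`.
-/

namespace Literature.InformationTheory.QuantumCodes.BB.Code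

open Matrix

variable {ℓ m : ℕ} [NeZero ℓ] [NeZero m] (C : Code ℓ m)

/-- **Translation-orbit reduction for `QC(A, B)`, orbit-minimal form.** Fix any ranking `key` of
vectors with values in a well-ordered type (e.g. the colex rank of the support as a bitmask).  If a
`Z`-logical (`H^X v = 0`, `v ∉ rs H^Z`) of weight `≤ w` exists, then one exists whose `key` is minimal
among its `ℓm` translates `v ∘ (translate t)⁻¹` — so an enumerator that visits only translation-minimal
patterns still finds a `Z`-logical of weight `≤ w` whenever there is one.
[cite: BravyiEtAl2024, SI §9.2 (arXiv:2308.07915, chunk p0021 L60 – p0022 L12)] -/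
theorem exists_zLogical_key_le_translate {β : Type*} [LinearOrder β] [WellFoundedLT β]
    (key : (Mono ℓ m ⊕ Mono ℓ m → ZMod 2) → β) {w : ℕ}
    (hex : ∃ v : Mono ℓ m ⊕ Mono ℓ m → ZMod 2, C.HX *ᵥ v = 0 ∧ v ∉ rowSpace C.HZ ∧ hammingNorm v ≤ w) :
    ∃ v : Mono ℓ m ⊕ Mono ℓ m → ZMod 2, C.HX *ᵥ v = 0 ∧ v ∉ rowSpace C.HZ ∧ hammingNorm v ≤ w ∧
      ∀ t : Mono ℓ m, key v ≤ key (v ∘ (translate t).symm) := by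
  have hS : ∀ σ ∈ Set.range (translate (ℓ := ℓ) (m := m)),
      ∀ v ∈ {v : Mono ℓ m ⊕ Mono ℓ m → ZMod 2 | C.HX *ᵥ v = 0 ∧ v ∉ rowSpace C.HZ ∧ hammingNorm v ≤ w},
      v ∘ σ.symm ∈ {v : Mono ℓ m ⊕ Mono ℓ m → ZMod 2 |
        C.HX *ᵥ v = 0 ∧ v ∉ rowSpace C.HZ ∧ hammingNorm v ≤ w} := by
    rintro _ ⟨t, rfl⟩ v ⟨hv, hv', hw⟩
    refine ⟨?_, ?_, ?_⟩
    · exact (mulVec_comp_equiv_symm_eq_zero_iff (C.HX_submatrix_translate t) v).2 hv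
    · exact fun h => hv' ((comp_equiv_symm_mem_rowSpace_iff (C.HZ_submatrix_translate t) v).1 h)
    · rwa [BB.hammingNorm_comp_equiv v (translate t).symm]
  obtain ⟨v, hv, hv', hw⟩ := hex
  obtain ⟨v₀, ⟨h₁, h₂, h₃⟩, hmin⟩ := exists_mem_key_le hS key ⟨v, ⟨hv, hv', hw⟩⟩
  exact ⟨v₀, h₁, h₂, h₃, fun t => hmin (translate t) ⟨t, rfl⟩⟩

/-- **Lower bounds may be checked on translation-minimal `Z`-logicals only**: if every `Z`-logical
whose `key` is minimal among its translates has weight `> w`, then every `Z`-logical has weight `> w`.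
[cite: BravyiEtAl2024, SI §9.2 (arXiv:2308.07915, chunk p0021 L60 – p0022 L12)] -/
theorem lt_hammingNorm_zLogical_of_key_le_translate {β : Type*} [LinearOrder β] [WellFoundedLT β]
    (key : (Mono ℓ m ⊕ Mono ℓ m → ZMod 2) → β) {w : ℕ}
    (h : ∀ v : Mono ℓ m ⊕ Mono ℓ m → ZMod 2, C.HX *ᵥ v = 0 → v ∉ rowSpace C.HZ →
      (∀ t : Mono ℓ m, key v ≤ key (v ∘ (translate t).symm)) → w < hammingNorm v)
    (v : Mono ℓ m ⊕ Mono ℓ m → ZMod 2) (hv : C.HX *ᵥ v = 0) (hv' : v ∉ rowSpace C.HZ) :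
    w < hammingNorm v := by
  by_contra hle
  obtain ⟨v₀, h₁, h₂, h₃, hmin⟩ := C.exists_zLogical_key_le_translate key ⟨v, hv, hv', not_lt.1 hle⟩
  exact absurd h₃ (not_le.2 (h v₀ h₁ h₂ hmin))

/-- **Orbit-minimal certificate lemma for the distance of `QC(A, B)`**: an explicit `Z`-logical of
weight `d` plus "every `Z`-logical that is `key`-minimal among its translates has weight `≥ d`" gives
`C.d = d` — the shape of a kernel-A certificate enumerating one pattern per translation orbit
(`|ℤ_ℓ × ℤ_m| = ℓm`-fold reduction; `72` for `[[144,12,12]]`).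
[cite: BravyiEtAl2024, Lemma 1 and SI §9.2 (arXiv:2308.07915, chunk p0009 L74–77; p0021 L60 – p0022 L12)] -/
theorem d_eq_of_witness_of_key_le_translate {β : Type*} [LinearOrder β] [WellFoundedLT β]
    (key : (Mono ℓ m ⊕ Mono ℓ m → ZMod 2) → β) {d : ℕ} {v : Mono ℓ m ⊕ Mono ℓ m → ZMod 2}
    (hv : C.HX *ᵥ v = 0) (hv' : v ∉ rowSpace C.HZ) (hwt : hammingNorm v = d)
    (h : ∀ w : Mono ℓ m ⊕ Mono ℓ m → ZMod 2, C.HX *ᵥ w = 0 → w ∉ rowSpace C.HZ →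
      (∀ t : Mono ℓ m, key w ≤ key (w ∘ (translate t).symm)) → d ≤ hammingNorm w) :
    C.d = d := by
  rw [d_eq_dZ]
  refine le_antisymm (hwt ▸ C.css.dZ_le_hammingNorm hv hv') (C.css.le_dZ ⟨v, hv, hv'⟩ fun w hw hw' => ?_)
  rcases Nat.eq_zero_or_pos d with h0 | hpos
  · rw [h0]; exact Nat.zero_le _
  · exact C.lt_hammingNorm_zLogical_of_key_le_translate key (w := d - 1)
      (fun u hu hu' hmin => by have := h u hu hu' hmin; omega) w hw hw' |> fun hlt => by omega

end Literature.InformationTheory.QuantumCodes.BB.Code
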